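import Summits.CriticalPhenomena.PercolationContinuityZ3.Theorems.PercNearOneGluingNoHeavyQuantPassageTimeSupercritical
import Summits.CriticalPhenomena.PercolationContinuityZ3.Theorems.PercNearOneGluingNoHeavyQuantThetaSmooth
import Summits.CriticalPhenomena.PercolationContinuityZ3.Theorems.PercNearOneGluingNoHeavyQuantThetaRightLipschitz
import HarnessLib

/-!
# QUANT lane (p4 gen 20): the passage time to infinity against the DERIVATIVE of `θ` and the finite-cluster susceptibility —
# `E_s[ρ] ≤ θ′(s)/(4θ(s)) ≤ d·χ^f(s)/(2(1−s))` for `s ∈ (p_c, 1)`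

builds on p205010 (kernel theorem, internal audit signed; external expert review pending) — NOT used in this file.

Seat `prim-quant-p4` (METHOD = differential inequalities for `θ` near `p_c`), helper file `--supports
stmt-CriticalPhenomena-4575`; pure proofs, no definitions.  Notation: `ρ` the Bernoulli first-passage time to infinity,
`meanRhoUpTo d K p = Σ_{k<K} P_p(ρ > k)` (partial sums of `E_p[ρ]`; `…QuantPassageTimeDefs`), `θ(r) = θ(prm r)`,
`χ^f(r) = meanClusterSize (zdGraph d) 0 (prm r)` (finite on `(p_c,1)` by Kesten–Zhang, tree), `p_c = criticalProbI d`.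

Letting `r ↑ s` in the steepness bound `Σ_{k<K} P_s(ρ > k) ≤ log(θ(s)/θ(r))/(4(s−r))`
(`PassTime.meanRhoUpTo_le_log_div`, Grimmett 2006 (2.56) for the arm events) and using the differentiability of `θ∘prm` on
`(p_c,1)` (Grimmett Thm. (8.92); tree `ChiF.differentiableAt_theta`):

* **`meanRhoUpTo_le_deriv_div`** — `Σ_{k<K} P_s(ρ > k) ≤ θ′(s)/(4θ(s))` for every `K`, `s ∈ (p_c,1)`, `d ≥ 2`: the pointwise form
  `d/dp log θ ≥ 4·E_p[ρ]` of exponential steepness for the infinite cluster;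
* **`meanRhoUpTo_le_chiF`** — with the Aizenman–Barsky / Durrett bound `θ′ ≤ 2dθχ^f/(1−s)` (tree `ChiF.hasDerivAt_theta_le`):
  `Σ_{k<K} P_s(ρ > k) ≤ d·χ^f(s)/(2(1−s))` — **the mean passage time to infinity is at most `d/(2(1−s))` times the mean size of
  the finite cluster of the origin**, throughout the supercritical phase.

HONEST STATUS.  New as typed (two tree theorems composed with this generation's steepness bound); not found in print.  In
mean field `E[ρ]` is expected to grow only logarithmically in `1/(p−p_c)` while `χ^f ≍ (p−p_c)^{−1}`, so the bound is not
sharp; no rate at `p_c`; (T1)/(T2) unchanged.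

## References
* G. Grimmett, *The Random-Cluster Model* (2006), Thm. (2.53), (2.56) [GrimmettRandomCluster2006].
* M. Aizenman, D. J. Barsky, Comm. Math. Phys. 108 (1987), (1.13) [AizenmanBarsky1987]; R. Durrett, ZfW 69 (1985) (5) [Durrett1985].
* G. Grimmett, *Percolation* (1999), Thm. (8.92) [GrimmettPercolation1999].
* A. Auffinger, M. Damron, J. Hanson (2017), §3.7.1 (3.25) [AuffingerDamronHanson2017].
-/

noncomputable section

namespace Summit.CriticalPhenomena.PercolationContinuityZ3.Theorems

namespace PassTime

open MeasureTheory Set Filter Literature.Probability.Percolation Literature.Probability.LatticeModels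
open scoped Classical Topology

variable {d : ℕ}

/-- **`Σ_{k<K} P_s(ρ > k) ≤ θ′(s)/(4θ(s))`** for `d ≥ 2`, `s ∈ (p_c,1)` and every `K` — the steepness bound
`log θ(s) − log θ(r) ≥ 4(s−r)Σ_{k<K}P_s(ρ>k)` divided by `s − r`, in the limit `r ↑ s`. -/
theorem meanRhoUpTo_le_deriv_div (hd : 2 ≤ d) {s : ℝ} (hs : s ∈ Set.Ioo (criticalProbI d : ℝ) 1) (K : ℕ) :
    meanRhoUpTo d K (Set.projIcc 0 1 zero_le_one s) ≤
      deriv (fun r : ℝ => theta (zdGraph d) 0 (Set.projIcc 0 1 zero_le_one r)) s /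
        (4 * theta (zdGraph d) 0 (Set.projIcc 0 1 zero_le_one s)) := by
  have hpc : criticalProb (zdGraph d) (0 : Site d) < s := by rw [← coe_criticalProbI]; exact hs.1
  set θf : ℝ → ℝ := fun r => theta (zdGraph d) 0 (Set.projIcc 0 1 zero_le_one r) with hθf
  set M : ℝ := meanRhoUpTo d K (Set.projIcc 0 1 zero_le_one s) with hM
  have hcs : ((Set.projIcc (0 : ℝ) 1 zero_le_one s : unitInterval) : ℝ) = s :=
    congrArg Subtype.val (Set.projIcc_of_mem zero_le_one ⟨le_of_lt ((criticalProbI d).2.1.trans_lt hs.1), hs.2.le⟩)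
  have hθs : 0 < θf s :=
    theta_pos_of_criticalProb_lt_holds (zdGraph d) 0 _ (by rw [hcs]; exact hpc)
  -- derivative of `log θ` at `s`
  have hD : HasDerivAt θf (deriv θf s) s := (ChiF.differentiableAt_theta hd hs).hasDerivAt
  have hg : HasDerivAt (fun r => Real.log (θf r)) (deriv θf s / θf s) s := hD.log hθs.ne'
  -- slopes from the left are at least `4M`
  have hslope : Tendsto (slope (fun r => Real.log (θf r)) s) (𝓝[<] s) (𝓝 (deriv θf s / θf s)) :=
    hg.tendsto_slope.mono_left (nhdsWithin_mono s (show Set.Iio s ⊆ {s}ᶜ from fun r hr => ne_of_lt hr))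
  have hev : ∀ᶠ r in 𝓝[<] s, 4 * M ≤ slope (fun r => Real.log (θf r)) s r := by
    filter_upwards [Ioo_mem_nhdsLT hpc] with r hr
    have hθr : 0 < θf r := by
      have hcr : ((Set.projIcc (0 : ℝ) 1 zero_le_one r : unitInterval) : ℝ) = r :=
        congrArg Subtype.val (Set.projIcc_of_mem zero_le_one
          ⟨le_of_lt (((criticalProb_mem_Icc _ _).1).trans_lt hr.1), hr.2.le.trans hs.2.le⟩)
      exact theta_pos_of_criticalProb_lt_holds (zdGraph d) 0 _ (by rw [hcr]; exact hr.1)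
    have h := meanRhoUpTo_le_log_div hd hr.1 hr.2 hs.2 K
    rw [Real.log_div hθs.ne' hθr.ne'] at h
    rw [slope_def_field]
    have hsr : 0 < s - r := by linarith [hr.2]
    rw [le_div_iff₀ (by linarith : 0 < 4 * (s - r))] at h
    rw [le_div_iff_of_neg (by linarith : r - s < 0)]
    show Real.log (θf r) - Real.log (θf s) ≤ 4 * M * (r - s)
    linarith
  have h4M : 4 * M ≤ deriv θf s / θf s := ge_of_tendsto hslope hev
  rw [le_div_iff₀ (by positivity)]
  have := (le_div_iff₀ hθs).1 h4M
  linarith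

/-- **`Σ_{k<K} P_s(ρ > k) ≤ d·χ^f(s)/(2(1−s))`** for `d ≥ 2`, `s ∈ (p_c,1)`, every `K`: the mean Bernoulli first-passage time to
infinity is at most `d/(2(1−s))` times the mean size `χ^f(s)` of the finite cluster of the origin (steepness + the
Aizenman–Barsky/Durrett bound `θ′ ≤ 2dθχ^f/(1−s)`, with `χ^f(s) < ∞` by Kesten–Zhang). -/
theorem meanRhoUpTo_le_chiF (hd : 2 ≤ d) {s : ℝ} (hs : s ∈ Set.Ioo (criticalProbI d : ℝ) 1) (K : ℕ) :
    meanRhoUpTo d K (Set.projIcc 0 1 zero_le_one s) ≤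
      d * (meanClusterSize (zdGraph d) (0 : Site d) (Set.projIcc 0 1 zero_le_one s)).toReal / (2 * (1 - s)) := by
  have hpc0 : 0 < (criticalProbI d : ℝ) := by rw [coe_criticalProbI]; exact criticalProb_zd_pos d (by omega)
  have hs0 : 0 < s := hpc0.trans hs.1
  have hcs : ((Set.projIcc (0 : ℝ) 1 zero_le_one s : unitInterval) : ℝ) = s :=
    congrArg Subtype.val (Set.projIcc_of_mem zero_le_one ⟨hs0.le, hs.2.le⟩)
  set θf : ℝ → ℝ := fun r => theta (zdGraph d) 0 (Set.projIcc 0 1 zero_le_one r) with hθf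
  set X : ℝ := (meanClusterSize (zdGraph d) (0 : Site d) (Set.projIcc 0 1 zero_le_one s)).toReal with hX
  have hθs : 0 < θf s := theta_pos_of_criticalProb_lt_holds (zdGraph d) 0 _
    (by rw [hcs, ← coe_criticalProbI]; exact hs.1)
  have hD : HasDerivAt θf (deriv θf s) s := (ChiF.differentiableAt_theta hd hs).hasDerivAt
  have hχ := (ChiF.meanClusterSize_prm_lt_top hd hs.1 hs.2.le).ne
  have hle : deriv θf s ≤ 2 * d * θf s * X / (1 - s) := ChiF.hasDerivAt_theta_le hs0 hs.2 hχ hD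
  have h1 := meanRhoUpTo_le_deriv_div hd hs K
  have hX0 : 0 ≤ X := ENNReal.toReal_nonneg
  have h1s : 0 < 1 - s := by linarith [hs.2]
  calc meanRhoUpTo d K (Set.projIcc 0 1 zero_le_one s) ≤ deriv θf s / (4 * θf s) := h1
    _ ≤ (2 * d * θf s * X / (1 - s)) / (4 * θf s) := div_le_div_of_nonneg_right hle (by positivity)
    _ = d * X / (2 * (1 - s)) := by field_simp; ring

end PassTime

end Summit.CriticalPhenomena.PercolationContinuityZ3.Theorems

end
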